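import Mathlib
import Summits.NavierStokesRegularity.NavierStokesRegularity.Theorems.FilamentSkeletonRssClause13SmoothingKernelPlancherel
import Summits.NavierStokesRegularity.NavierStokesRegularity.Theorems.FilamentSkeletonRssClause13ModelSelfForm

/-!
# Clause 13-J, brick B5 (band virial, symbol side): the FIRST MOMENT of the smoothing kernel is `L¹`,
# `𝓕K_q` is `C¹`, `𝔖` is differentiable, and `𝓕(x·K_q) = (i/2π)·(𝓕K_q)′`

Route `FilamentSkeletonRss`, child `Clause13NearStraightL` (stmt-NavierStokesRegularity-23321; typing-agnostic); design of record
`filament-plan/DESIGN-NOTE-28296-tenure-g22.md` §4 ("[τ, m(D)] = −i m′(D)": the commutator of the conjugate operator `τ − c` with the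
convolution `K_q∗` has kernel `(τ−σ)K_q(τ−σ)`, brick `…Clause13KernelVirial`, p670953; its multiplier is the DERIVATIVE of the multiplier
`𝓕K_q(ξ) = (2/q)(1 − 𝔖(2πξ√q))` of p664709).  This file supplies the analytic input: `x·K_q(x) ∈ L¹` (`|x·K_q(x)| ≤ 2·max(1,1/q)·(1+x²)⁻¹`),
hence (Mathlib `Real.hasDerivAt_fourier`) `𝓕K_q` is differentiable with `(𝓕K_q)′ = 𝓕(x ↦ −2πi·x·K_q(x))`, i.e.
`𝓕(x ↦ x·K_q(x)) = (i/2π)·(𝓕K_q)′`; and the symbol `𝔖 = 1 − ½·Re 𝓕K_1(·/2π)` is differentiable on `ℝ`.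
Lane ns-filament-19175-p1 g14; `--supports stmt-NavierStokesRegularity-23321 --as helper`.
HONEST FRAMING: harmonic analysis of an explicit model kernel attached to a HYPOTHETICAL filament skeleton on the NEGATIVE side of a MODEL
route; nothing here bears on Navier–Stokes regularity or blow-up.
-/

noncomputable section

open MeasureTheory Real Complex Filter Set
open scoped FourierTransform
open Summit.NavierStokesRegularity.NavierStokesRegularity.Theorems.AnalyticStripLiaSymbol (liaSym)

namespace Summit.NavierStokesRegularity.NavierStokesRegularity.Theorems.MatchedKernel
set_option linter.dupNamespace false

/-- First-moment bound: `|x·K_q(x)| ≤ 2·max(1, q⁻¹)·(1+x²)⁻¹`. [folklore] -/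
theorem abs_mul_smoothingKernel_le {q : ℝ} (hq : 0 < q) (s : ℝ) :
    |s * ((2 * q - s ^ 2) * ((s ^ 2 + q) ^ (5 / 2 : ℝ))⁻¹)| ≤ 2 * max 1 q⁻¹ * (1 + s ^ 2)⁻¹ := by
  have hσ : 0 < s ^ 2 + q := by positivity
  have hK := abs_smoothingKernel_le hq s
  -- `|s| ≤ (s²+q)^{1/2}` and `(s²+q)^{3/2} = (s²+q)·(s²+q)^{1/2}`
  have hs : |s| ≤ (s ^ 2 + q) ^ (1 / 2 : ℝ) := by
    rw [← Real.sqrt_eq_rpow, ← Real.sqrt_sq_eq_abs]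
    exact Real.sqrt_le_sqrt (by linarith)
  have h32 : (s ^ 2 + q) ^ (3 / 2 : ℝ) = (s ^ 2 + q) * (s ^ 2 + q) ^ (1 / 2 : ℝ) := by
    rw [show (3 / 2 : ℝ) = 1 + 1 / 2 by norm_num, Real.rpow_add hσ, Real.rpow_one]
  have hhalf : 0 < (s ^ 2 + q) ^ (1 / 2 : ℝ) := Real.rpow_pos_of_pos hσ _
  -- `|s|·(s²+q)^{-3/2} ≤ (s²+q)⁻¹`
  have h1 : |s| * ((s ^ 2 + q) ^ (3 / 2 : ℝ))⁻¹ ≤ (s ^ 2 + q)⁻¹ := by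
    rw [h32, mul_inv, ← mul_assoc, mul_comm |s|, mul_assoc]
    calc (s ^ 2 + q)⁻¹ * (|s| * ((s ^ 2 + q) ^ (1 / 2 : ℝ))⁻¹)
        ≤ (s ^ 2 + q)⁻¹ * 1 := by
          refine mul_le_mul_of_nonneg_left ?_ (inv_nonneg.2 hσ.le)
          rw [mul_inv_le_iff₀ hhalf, one_mul]; exact hs
      _ = (s ^ 2 + q)⁻¹ := mul_one _
  -- `(s²+q)⁻¹ ≤ max(1, q⁻¹)·(1+s²)⁻¹`
  have h2 : (s ^ 2 + q)⁻¹ ≤ max 1 q⁻¹ * (1 + s ^ 2)⁻¹ := by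
    have h1s : 0 < 1 + s ^ 2 := by positivity
    rw [← div_eq_mul_inv, le_div_iff₀ h1s, inv_mul_le_iff₀ hσ]
    rcases le_or_gt 1 q with hq1 | hq1
    · calc 1 + s ^ 2 ≤ s ^ 2 + q := by linarith
        _ ≤ (s ^ 2 + q) * max 1 q⁻¹ := le_mul_of_one_le_right hσ.le (le_max_left _ _)
    · have hqi : 1 ≤ q⁻¹ := (one_le_inv₀ hq).2 hq1.le
      calc 1 + s ^ 2 ≤ (s ^ 2 + q) * q⁻¹ := by
            rw [add_mul, mul_inv_cancel₀ hq.ne']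
            nlinarith [sq_nonneg s]
        _ ≤ (s ^ 2 + q) * max 1 q⁻¹ := mul_le_mul_of_nonneg_left (le_max_right _ _) hσ.le
  calc |s * ((2 * q - s ^ 2) * ((s ^ 2 + q) ^ (5 / 2 : ℝ))⁻¹)|
      = |s| * |(2 * q - s ^ 2) * ((s ^ 2 + q) ^ (5 / 2 : ℝ))⁻¹| := abs_mul _ _
    _ ≤ |s| * (2 * ((s ^ 2 + q) ^ (3 / 2 : ℝ))⁻¹) := mul_le_mul_of_nonneg_left hK (abs_nonneg _)
    _ = 2 * (|s| * ((s ^ 2 + q) ^ (3 / 2 : ℝ))⁻¹) := by ring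
    _ ≤ 2 * (s ^ 2 + q)⁻¹ := by linarith [h1]
    _ ≤ 2 * (max 1 q⁻¹ * (1 + s ^ 2)⁻¹) := by linarith [h2]
    _ = 2 * max 1 q⁻¹ * (1 + s ^ 2)⁻¹ := by ring

/-- The first moment `x·K_q(x)` is integrable (real form). [folklore] -/
theorem integrable_mul_smoothingKernel {q : ℝ} (hq : 0 < q) :
    Integrable (fun s : ℝ => s * ((2 * q - s ^ 2) * ((s ^ 2 + q) ^ (5 / 2 : ℝ))⁻¹)) := by
  refine Integrable.mono' (integrable_inv_one_add_sq.const_mul (2 * max 1 q⁻¹))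
    ((continuous_id.mul (continuous_smoothingKernel hq)).aestronglyMeasurable) (Eventually.of_forall fun s => ?_)
  rw [Real.norm_eq_abs]
  exact abs_mul_smoothingKernel_le hq s

/-- The first moment in the form `Real.hasDerivAt_fourier` wants: `x • (K_q x : ℂ)` integrable. [folklore] -/
theorem integrable_smul_smoothingKernel {q : ℝ} (hq : 0 < q) :
    Integrable (fun s : ℝ => s • ((((2 * q - s ^ 2) * ((s ^ 2 + q) ^ (5 / 2 : ℝ))⁻¹ : ℝ)) : ℂ)) := by
  have h := (integrable_mul_smoothingKernel hq).ofReal (𝕜 := ℂ)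
  refine h.congr (Eventually.of_forall fun s => ?_)
  show (((s * ((2 * q - s ^ 2) * ((s ^ 2 + q) ^ (5 / 2 : ℝ))⁻¹) : ℝ)) : ℂ)
      = s • ((((2 * q - s ^ 2) * ((s ^ 2 + q) ^ (5 / 2 : ℝ))⁻¹ : ℝ)) : ℂ)
  rw [Complex.real_smul, Complex.ofReal_mul]

/-- **`𝓕K_q` is differentiable**, with derivative `𝓕(x ↦ (−2πi x)•K_q(x))`. [folklore] -/
theorem hasDerivAt_fourier_smoothingKernel {q : ℝ} (hq : 0 < q) (ξ : ℝ) :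
    HasDerivAt (𝓕 (fun s : ℝ => (((2 * q - s ^ 2) * ((s ^ 2 + q) ^ (5 / 2 : ℝ))⁻¹ : ℝ) : ℂ)))
      (𝓕 (fun s : ℝ => (-2 * π * I * s) • ((((2 * q - s ^ 2) * ((s ^ 2 + q) ^ (5 / 2 : ℝ))⁻¹ : ℝ)) : ℂ)) ξ) ξ :=
  Real.hasDerivAt_fourier (integrable_smoothingKernel hq) (integrable_smul_smoothingKernel hq) ξ

/-- **The multiplier of the commutator kernel**: `𝓕(x ↦ x·K_q(x))(ξ) = (i/2π)·(𝓕K_q)′(ξ)`. [folklore] -/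
theorem fourier_mul_smoothingKernel_eq_deriv {q : ℝ} (hq : 0 < q) (ξ : ℝ) :
    𝓕 (fun s : ℝ => (((s * ((2 * q - s ^ 2) * ((s ^ 2 + q) ^ (5 / 2 : ℝ))⁻¹) : ℝ)) : ℂ)) ξ
      = (I / (2 * π)) * deriv (𝓕 (fun s : ℝ => (((2 * q - s ^ 2) * ((s ^ 2 + q) ^ (5 / 2 : ℝ))⁻¹ : ℝ) : ℂ))) ξ := by
  rw [(hasDerivAt_fourier_smoothingKernel hq ξ).deriv]
  -- pull the constant `−2πi` out of the transform
  set G : ℝ → ℂ := fun s : ℝ => (((s * ((2 * q - s ^ 2) * ((s ^ 2 + q) ^ (5 / 2 : ℝ))⁻¹) : ℝ)) : ℂ) with hG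
  have hlin : (fun s : ℝ => (-2 * π * I * s) • ((((2 * q - s ^ 2) * ((s ^ 2 + q) ^ (5 / 2 : ℝ))⁻¹ : ℝ)) : ℂ))
      = (-2 * π * I : ℂ) • G := by
    funext s; simp only [hG, Pi.smul_apply, smul_eq_mul]; push_cast; ring
  have hsm : 𝓕 ((-2 * π * I : ℂ) • G) = (-2 * π * I : ℂ) • 𝓕 G :=
    VectorFourier.fourierIntegral_const_smul _ _ _ _ _
  rw [hlin, hsm, Pi.smul_apply, smul_eq_mul, ← mul_assoc]
  have hI : I / (2 * π) * (-2 * π * I) = 1 := by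
    field_simp
    rw [Complex.I_sq]; ring
  rw [hI, one_mul]

/-- **`𝔖` is differentiable** (`𝔖(x) = 1 − ½ Re 𝓕K_1(x/2π)`). [folklore] -/
theorem differentiable_liaSym : Differentiable ℝ liaSym := by
  have hfun : liaSym = fun x => 1 - (𝓕 (fun s : ℝ => (((2 * 1 - s ^ 2) * ((s ^ 2 + 1) ^ (5 / 2 : ℝ))⁻¹ : ℝ) : ℂ))
      (x / (2 * π))).re / 2 := by
    funext x
    rw [fourier_smoothingKernel one_pos, Complex.ofReal_re, Real.sqrt_one, mul_one,
      show 2 * π * (x / (2 * π)) = x by field_simp]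
    ring
  rw [hfun]
  have hF : Differentiable ℝ (𝓕 (fun s : ℝ => (((2 * 1 - s ^ 2) * ((s ^ 2 + 1) ^ (5 / 2 : ℝ))⁻¹ : ℝ) : ℂ))) :=
    fun ξ => (hasDerivAt_fourier_smoothingKernel one_pos ξ).differentiableAt
  have hre : Differentiable ℝ (fun z : ℂ => z.re) := Complex.reCLM.differentiable
  exact ((differentiable_const _).sub ((hre.comp (hF.comp (differentiable_id.div_const _))).div_const _))

end Summit.NavierStokesRegularity.NavierStokesRegularity.Theorems.MatchedKernel

end
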